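import Mathlib
import Literature.AlgebraicGeometry.HodgeTheory.RationallyNormalisedDeRhamFamily
import Literature.AlgebraicGeometry.HodgeTheory.HodgeTypeExteriorProduct
import Literature.AlgebraicGeometry.Motives.BaseChangeProofs
import HarnessLib

/-!
# ConjugationChartUniqueness

Topic `Literature/AlgebraicGeometry/HodgeTheory`. Named literature fact(s) relocated by the gate from `Summits/HodgeConjecture/HodgeConjecture/Theorems/BoundaryReadoutBoundaryAbsolutenessConjugateNaturality.lean`
(accept-time relocation of `[cite]`d propositions written inline in a Summits proposal; human ruling 2026-08-15).
Sources: CharlesSchnell2014Notes, ConnerFloyd1964, Grothendieck1966.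

* `Literature.AlgebraicGeometry.HodgeTheory.chartConjugation_canonical`
-/

namespace Literature.AlgebraicGeometry.HodgeTheory

open CategoryTheory AlgebraicGeometry
open scoped Manifold ContDiff
open Literature.AlgebraicGeometry.Motives Literature.AlgebraicGeometry.HodgeTheory
open Literature.NumberTheory.Transcendental Literature.Geometry.Kaehler

/-- **Chart conjugation is canonical, `σ`-linear and natural** (named fact). For every `σ ∈ Aut ℂ` and
degree `k` there are maps `θ_X : Hᵏ(X(ℂ); ℂ) → Hᵏ(X^σ(ℂ); ℂ)` (`X` a `ℂ`-scheme) such that: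
(i) each `θ_X` is `σ`-semilinear; (ii) NATURALITY: `θ_Y (g^* c) = (g^σ)^* (θ_X c)` for every `ℂ`-morphism
`g : Y ⟶ X` into a smooth projective `X` from a `Y` which is smooth projective or smooth affine;
(iii) COMPUTED BY CHARTS: for `Y` smooth affine, analytic models `A` of `Y` and `A'` of `Y^σ` charted on
one model space `E`, a natural complex de Rham family `e` on `E`-manifolds rationally normalised in
degree `k`, and an algebraic `k`-form expression `ξ` on `Y` with closed realisations: if
`A^* c = e[ξ.realize A]` then `A'^* (θ_Y c) = e[(ξ.conj σ).realize A']`.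
Source: for `X` smooth over `ℂ`, `θ_X` is Charles–Schnell's `α ↦ α^σ` — pull-back of Kähler forms along
the abstract isomorphism `σ⁻¹ : X^σ → X` is a `σ`-linear isomorphism of algebraic de Rham complexes
(11.2.2), whence `(σ⁻¹)^* : H^*(X/ℂ) ⥲ H^*(X^σ/ℂ)`, `(λα)^σ = σ(λ) α^σ` (11.2.3) — read in singular
cohomology through Grothendieck's canonical comparison isomorphisms `H^*(X/ℂ) ≅ H^*(X^an, ℂ)`
(Thm. 11.1.2; for smooth affine `Y`, `H^*(Γ(Y, Ω•)) ⥲ H^*(Y^an; ℂ)`, Grothendieck 1966 Thm. 1', so the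
class of a closed algebraic form `ξ` goes to the class of `ξ^σ`); both constructions are functorial in
`X`, which is (ii); (iii) is the affine computation, the de Rham family entering only through the
rational constant by which a natural, rationally normalised family differs from integration in degree
`k` (rational homology classes of manifolds are Steenrod-representable up to odd multiples,
Conner–Floyd (15.3), and such a family is pinned on `Sᵏ × ℝ^{2m-k}` and on tori — the junk analysis (2)
of `AbsoluteHodgeClasses`); on `ℂ`-schemes that are not smooth varieties `θ_X` is unconstrained by
(ii)–(iii) (take `0`). This is exactly the assertion "all charts agree and compute `α ↦ α^σ`" in the
docstring of `IsConjugateClass`; it yields uniqueness and naturality of conjugate classes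
(`isConjugateClass_unique_of_canonical`, `conjugateNaturality_of_canonical`).
[cite: CharlesSchnell2014Notes, §11.2.2 (11.2.2)–(11.2.3) and Thm. 11.1.2]
[cite: Grothendieck1966, Thm. 1'] [cite: ConnerFloyd1964, (15.3)]
[file AlgebraicGeometry/HodgeTheory/ConjugationChartUniqueness] -/
def chartConjugation_canonical : Prop :=
  ∀ (σ : ℂ ≃+* ℂ) (k : ℕ),
    ∃ θ : ∀ X : SchemeOver ℂ, complexBetti X k → complexBetti (conjugateVariety σ X) k,
      (∀ (X : SchemeOver ℂ) (a : ℂ) (c₁ c₂ : complexBetti X k),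
          θ X (a • c₁ + c₂) = σ a • θ X c₁ + θ X c₂) ∧
      (∀ ⦃n : ℕ⦄ ⦃X : SchemeOver ℂ⦄, IsSmoothProjective n X →
        ∀ ⦃Y : SchemeOver ℂ⦄ (g : Y ⟶ X),
          ((∃ m, IsSmoothProjective m Y) ∨ (_root_.AlgebraicGeometry.IsAffine Y.left ∧
            ∃ m, _root_.AlgebraicGeometry.SmoothOfRelativeDimension m Y.hom)) →
          ∀ c : complexBetti X k, θ Y (complexBetti.map g k c) = complexBetti.map (conjHom σ g) k (θ X c)) ∧
      (∀ (E : Type) [NormedAddCommGroup E] [NormedSpace ℂ E] [FiniteDimensional ℂ E]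
        (e : ComplexDeRhamIsoFamily E), e.IsNatural → IsRationalDeRhamFamily e k →
        ∀ (m : ℕ) (Y : SchemeOver ℂ) [_root_.AlgebraicGeometry.IsAffine Y.left]
          [_root_.AlgebraicGeometry.SmoothOfRelativeDimension m Y.hom]
          (A : AnalyticModel E m Y) (A' : AnalyticModel E m (conjugateVariety σ Y))
          (ξ : AlgFormExpr Y k) (hξ : ξ.realize A ∈ cclosedSmoothForms E A.carrier k)
          (hξ' : (ξ.conj σ).realize A' ∈ cclosedSmoothForms E A'.carrier k) (c : complexBetti Y k),
          A.pullback k c = e A.carrier k (complexDeRhamCohomology.mk E A.carrier k ⟨_, hξ⟩) →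
          A'.pullback k (θ Y c) =
            e A'.carrier k (complexDeRhamCohomology.mk E A'.carrier k ⟨_, hξ'⟩))

end Literature.AlgebraicGeometry.HodgeTheory
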